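import Literature.ModelTheory.ExponentialFields.ClosedTermTransfer
import Literature.ModelTheory.ExponentialFields.MacintyreWilkie
import HarnessLib

/-!
# The weak theory `OEF` of ordered exponential fields and its models

Family `periods` (periods.S27), topic `Literature/ModelTheory/ExponentialFields`: infrastructure for
the conditional half of Macintyre–Wilkie's theorem
(`Literature.ModelTheory.ExponentialFields.macintyreWilkie_existential_of_schanuelProperty`; reduced
in `MacintyreWilkieREAxioms.lean` to exhibiting, under Schanuel's conjecture, a recursive set
`T₀ ⊆ Th(ℝ_exp)` — plus possibly an r.e. scheme of true sentences — of which every existential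
sentence true in `ℝ_exp` is a consequence).  Macintyre–Wilkie's `T₀` contains, and their
arguments about rational points, polynomial identities and existential reductions only use, a
*finite* list of elementary truths about `(ℝ; +, *, -, 0, 1, exp, ≤)`; Jones–Servi 2011
(transposing [MW96] to `x^α`), Def. 1.2: "[OF] Axioms of ordered field; …; [DE] the differential
equation …"; §3: Lemma 3.6 ("`T ⊢ h(q̄) < 0`"), Thm. 3.11 ("Since `T` contains the theory of real
closed fields, … transferred to every model of `T`").  This file fixes that finite true theory
for `exp` and proves that its models are what the downstream arguments need:

* `Literature.ModelTheory.ExponentialFields.Theory.OEF` — the finite `Language.orderedExpRing`-theory: linear order, ordered field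
  axioms, "non-negative elements are squares", `exp (x + y) = exp x * exp y`, `x + 1 ≤ exp x`
  (a definition: a finite set of sentences);
* `Real.model_OEF : ℝ ⊨ OEF` and `OEF_subset_realExpTheory` (so `OEF ⊆ Th(ℝ_exp)`);
* `Theory.IsRecursive.of_finite` (proved, any language): a finite set of sentences is recursive;
  hence `OEF_isRecursive`;
* for a bundled model `K : Theory.OEF.ModelType`, on its carrier: `Field`, `LinearOrder`,
  `IsStrictOrderedRing`, `RealExpModel.LawfulStructure` instances, the exponential
  `OEFModel.exp` with `OEFModel.isOrderedExp_exp : IsOrderedExp OEFModel.exp`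
  (`ClosedTermTransfer.lean`) and `funMap_exp`, squares of non-negatives
  (`OEFModel.exists_mul_self_eq`, `le_iff_exists_mul_self`, `lt_iff_exists_mul_self`) — the
  construction of `RealExpModels.lean` for models of `T_exp`, run from the axioms of `OEF`
  instead of by transfer from `ℝ`;
* `Theory.ModelsOEF T` (every axiom of `OEF` is a consequence of `T` — the *semantic* hypothesis,
  see its docstring) and `Theory.ModelType.toOEFModel`: a model of a theory proving `OEF` is a
  model of `OEF` with the same carrier and structure, so all of the above applies to the models
  of the theories of the decision procedure (`OEF ∪ S` here; any `T ⊇ OEF`; theories containing a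
  transport of the tree's `Theory.RCF` once the entailments are checked);
* `OEF_models_expFormulaLt_of_real` (proved): **`OEF ⊨ s < t` for all closed terms `s, t` with
  `ℝ ⊨ s < t`** — the theory-level form of `realize_lt_realize_of_real`
  (`ClosedTermTransfer.lean`; Jones–Servi 2011, Lemma 3.6), and its extension to every theory
  proving `OEF`.

Everything here is proved; `OEF` is not claimed to be anybody's printed axiom list (it is the
fragment of `Th(ℝ_exp)` these files use, named for reference), hence tagged folklore.  Relation
to the tree's `Language.orderedRing`-theories of `RealClosedFieldTheory.lean` (`Theory.orderedField`
= Mathlib's `Theory.field` transported + `linearOrderTheory` + monotonicity; `nonnegHasSqrtSentence`;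
`Theory.RCF`): those could be transported along `orderedRingHomOrderedExpRing` instead of the
hand-written list `OEF.algebraAxioms`, but the tree has no construction of the field structure on
an *abstract* bundled model of (transported) `Theory.orderedField` either (its realization lemmas
are for types already carrying `+, *, ≤`), which is the content needed here; the explicit list
keeps that construction elementary (`Field.ofMinimalAxioms`, as in `RealExpModels.lean`), and the
semantic hypothesis `Theory.ModelsOEF` makes the downstream API independent of the choice.

## Design

As in `RealExpModels.lean`, all instances live on the carrier `↥K` of a *bundled* model
`K : Theory.OEF.ModelType` (never on a bare type), so they cannot collide with the instances of
`ℝ` or of models of `realExpTheory`; `K` is not made an `ExponentialRing`.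

On the overlap with `RealExpModels.lean`: the constructions and the lemmas `exists_mul_self_eq`,
`le_iff_exists_mul_self`, `lt_iff_exists_mul_self` necessarily repeat their `RealExpModel`
namesakes in statement shape, but for the carriers of models of the *weaker* theory `OEF`:
every model of `realExpTheory` is a model of `OEF` (`Theory.ModelType.toOEFModel
OEF_subset_realExpTheory`), not conversely, so the versions here are the stronger ones that the
decision procedure needs (its theory `T₀` is recursive, hence far from complete) and they cannot
be obtained from the existing file; conversely `RealExpModels.lean` is left untouched (it is
imported by the Wilkie files), rather than re-derived through `toOEFModel`.

## References

* A. Macintyre, A. J. Wilkie, *On the decidability of the real exponential field*, in: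
  Kreiseliana, A K Peters (1996), 441–467.
* G. O. Jones, T. Servi, *On the decidability of the real field with a generic power function*,
  J. Symb. Log. 76 (2011), Def. 1.2, Lemma 3.6, Thm. 3.11.
-/

noncomputable section

open FirstOrder FirstOrder.Language FirstOrder.Language.Structure

universe w

namespace FirstOrder.Language.Theory

variable {L : Language} [Encodable (Σ i, L.Functions i)] [Encodable (Σ i, L.Relations i)]

/-- Membership in a finite set of natural numbers is a computable predicate (companion of
`Literature.ModelTheory.ExponentialFields.computablePred_or`; Mathlib has no such lemma). [folklore] -/
theorem _root_.Literature.ModelTheory.ExponentialFields.computablePred_mem_finset (S : Finset ℕ) :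
    ComputablePred fun n => n ∈ S := by
  classical
  induction S using Finset.induction_on with
  | empty =>
    refine ComputablePred.computable_iff.2 ⟨fun _ => false, Computable.const _, ?_⟩
    funext n
    simp
  | insert a S ha ih =>
    have hEq : ComputablePred fun n : ℕ => n = a :=
      ComputablePred.computable_iff.2 ⟨fun n => n == a, by
        exact (Primrec.beq.comp Primrec.id (Primrec.const a)).to_comp, by
        funext n; simp⟩
    refine (Literature.ModelTheory.ExponentialFields.computablePred_or hEq ih).of_eq fun n => ?_
    simp

/-- **A finite set of sentences is recursive** (its set of Gödel numbers is a finite set of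
naturals; deliberate dot-notation extension of the tree's `Theory.IsRecursive`,
`DecidableTheory.lean`). [folklore] -/
theorem IsRecursive.of_finite {T : L.Theory} (hT : T.Finite) : T.IsRecursive := by
  classical
  let S : Finset ℕ := hT.toFinset.image Sentence.godelNumber
  refine (Literature.ModelTheory.ExponentialFields.computablePred_mem_finset S).of_eq fun n => ?_
  simp only [S, Finset.mem_image, Set.Finite.mem_toFinset]

end FirstOrder.Language.Theory

namespace Literature.ModelTheory.ExponentialFields

/-! ### The sentences of `OEF` -/

namespace OEF

/-- `∀ x y z, (x + y) + z = x + (y + z)`. [folklore] -/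
def addAssoc : Language.orderedExpRing.Sentence := ∀' ∀' ∀' (((&0 + &1) + &2) =' (&0 + (&1 + &2)))
/-- `∀ x, 0 + x = x`. [folklore] -/
def zeroAdd : Language.orderedExpRing.Sentence := ∀' (((0 : Language.orderedExpRing.Term _) + &0) =' &0)
/-- `∀ x, -x + x = 0`. [folklore] -/
def negAddCancel : Language.orderedExpRing.Sentence := ∀' ((-&0 + &0) =' 0)
/-- `∀ x y z, (x * y) * z = x * (y * z)`. [folklore] -/
def mulAssoc : Language.orderedExpRing.Sentence := ∀' ∀' ∀' (((&0 * &1) * &2) =' (&0 * (&1 * &2)))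
/-- `∀ x y, x * y = y * x`. [folklore] -/
def mulComm : Language.orderedExpRing.Sentence := ∀' ∀' ((&0 * &1) =' (&1 * &0))
/-- `∀ x, 1 * x = x`. [folklore] -/
def oneMul : Language.orderedExpRing.Sentence := ∀' (((1 : Language.orderedExpRing.Term _) * &0) =' &0)
/-- `∀ x, x ≠ 0 → ∃ y, x * y = 1`. [folklore] -/
def existsInv : Language.orderedExpRing.Sentence := ∀' (∼(&0 =' 0) ⟹ ∃' ((&0 * &1) =' 1))
/-- `∀ x y z, x * (y + z) = x * y + x * z`. [folklore] -/
def leftDistrib : Language.orderedExpRing.Sentence :=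
  ∀' ∀' ∀' ((&0 * (&1 + &2)) =' ((&0 * &1) + (&0 * &2)))
/-- `0 ≠ 1`. [folklore] -/
def zeroNeOne : Language.orderedExpRing.Sentence := ∼((0 : Language.orderedExpRing.Term _) =' 1)
/-- `∀ x y z, x ≤ y → x + z ≤ y + z`. [folklore] -/
def addLeAdd : Language.orderedExpRing.Sentence :=
  ∀' ∀' ∀' ((&0).le &1 ⟹ Language.Term.le (&0 + &2) (&1 + &2))
/-- `0 ≤ 1`. [folklore] -/
def zeroLeOne : Language.orderedExpRing.Sentence := (0 : Language.orderedExpRing.Term _).le 1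
/-- `∀ x y, 0 < x → 0 < y → 0 < x * y`. [folklore] -/
def mulPos : Language.orderedExpRing.Sentence :=
  ∀' ∀' ((Language.Term.lt 0 &0) ⟹ ((Language.Term.lt 0 &1) ⟹ Language.Term.lt 0 (&0 * &1)))
/-- `∀ x, 0 ≤ x → ∃ y, y * y = x`. [folklore] -/
def squares : Language.orderedExpRing.Sentence :=
  ∀' ((0 : Language.orderedExpRing.Term _).le &0 ⟹ ∃' ((&1 * &1) =' &0))
/-- `∀ x y, exp (x + y) = exp x * exp y`. [folklore] -/
def expAdd : Language.orderedExpRing.Sentence :=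
  ∀' ∀' ((Language.orderedExpRing.termExp (&0 + &1)) ='
    (Language.orderedExpRing.termExp &0 * Language.orderedExpRing.termExp &1))
/-- `∀ x, x + 1 ≤ exp x`. [folklore] -/
def addOneLeExp : Language.orderedExpRing.Sentence :=
  ∀' (Language.Term.le (&0 + 1) (Language.orderedExpRing.termExp &0))

/-- The algebraic axioms of `OEF` (everything except the theory of linear orders). [folklore] -/
def algebraAxioms : Language.orderedExpRing.Theory :=
  {addAssoc, zeroAdd, negAddCancel, mulAssoc, mulComm, oneMul, existsInv, leftDistrib, zeroNeOne,
    addLeAdd, zeroLeOne, mulPos, squares, expAdd, addOneLeExp}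

end OEF

/-- **The weak theory `OEF` of ordered exponential fields** (in the language
`(+, *, -, 0, 1, exp, ≤)`): the theory of linear orders, the ordered field axioms, "non-negative
elements are squares", `exp (x + y) = exp x · exp y` and `x + 1 ≤ exp x`.  A finite set of
sentences true in `ℝ_exp`: the fragment of `Th(ℝ_exp)` used by the elementary steps of
Macintyre–Wilkie's decision procedure (compare Jones–Servi 2011, Def. 1.2, scheme [OF]). [folklore] -/
def Theory.OEF : Language.orderedExpRing.Theory :=
  Language.orderedExpRing.linearOrderTheory ∪ OEF.algebraAxioms

/-- `OEF` is a finite set of sentences. [folklore] -/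
theorem OEF_finite : Theory.OEF.Finite := by
  refine Set.Finite.union ?_ ?_
  · simp only [Language.linearOrderTheory, Language.partialOrderTheory, Language.preorderTheory]
    exact ((Set.finite_singleton _).insert _).insert _ |>.insert _
  · simp only [OEF.algebraAxioms]
    exact Set.toFinite _

/-- `OEF` is recursive (being finite). [folklore] -/
theorem OEF_isRecursive : Theory.OEF.IsRecursive :=
  Language.Theory.IsRecursive.of_finite OEF_finite

/-- `ℝ_exp ⊨ OEF`. [folklore] -/
instance Real.model_OEF : ℝ ⊨ Theory.OEF := by
  refine ⟨fun σ hσ => ?_⟩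
  rcases hσ with hσ | hσ
  · exact (Language.model_linearOrder (L := Language.orderedExpRing) (M := ℝ)).realize_of_mem σ hσ
  · simp only [OEF.algebraAxioms, Set.mem_insert_iff, Set.mem_singleton_iff] at hσ
    rcases hσ with rfl | rfl | rfl | rfl | rfl | rfl | rfl | rfl | rfl | rfl | rfl | rfl | rfl | rfl | rfl
    · simp [OEF.addAssoc, Sentence.Realize, Formula.Realize, Fin.snoc, add_assoc]
    · simp [OEF.zeroAdd, Sentence.Realize, Formula.Realize, Fin.snoc]
    · simp [OEF.negAddCancel, Sentence.Realize, Formula.Realize, Fin.snoc]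
    · simp [OEF.mulAssoc, Sentence.Realize, Formula.Realize, Fin.snoc, mul_assoc]
    · simp [OEF.mulComm, Sentence.Realize, Formula.Realize, Fin.snoc, mul_comm]
    · simp [OEF.oneMul, Sentence.Realize, Formula.Realize, Fin.snoc]
    · simp only [OEF.existsInv, Sentence.Realize, Formula.Realize, BoundedFormula.realize_all,
        BoundedFormula.realize_imp, BoundedFormula.realize_not, BoundedFormula.realize_bdEqual,
        BoundedFormula.realize_ex]
      intro x hx
      refine ⟨x⁻¹, ?_⟩
      simp [Fin.snoc] at hx ⊢
      exact mul_inv_cancel₀ hx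
    · simp [OEF.leftDistrib, Sentence.Realize, Formula.Realize, Fin.snoc, mul_add]
    · simp [OEF.zeroNeOne, Sentence.Realize, Formula.Realize]
    · simp only [OEF.addLeAdd, Sentence.Realize, Formula.Realize, BoundedFormula.realize_all,
        BoundedFormula.realize_imp, Term.realize_le]
      intro x y z hxy
      simpa [Fin.snoc] using hxy
    · simp [OEF.zeroLeOne, Sentence.Realize, Formula.Realize]
    · simp only [OEF.mulPos, Sentence.Realize, Formula.Realize, BoundedFormula.realize_all,
        BoundedFormula.realize_imp, Term.realize_lt]
      intro x y hx hy
      simp [Fin.snoc] at hx hy ⊢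
      exact mul_pos hx hy
    · simp only [OEF.squares, Sentence.Realize, Formula.Realize, BoundedFormula.realize_all,
        BoundedFormula.realize_imp, Term.realize_le, BoundedFormula.realize_ex,
        BoundedFormula.realize_bdEqual]
      intro x hx
      refine ⟨Real.sqrt x, ?_⟩
      simp [Fin.snoc] at hx ⊢
      exact Real.mul_self_sqrt hx
    · simp [OEF.expAdd, Sentence.Realize, Formula.Realize, Fin.snoc, Real.exp_add]
    · simp only [OEF.addOneLeExp, Sentence.Realize, Formula.Realize, BoundedFormula.realize_all,
        Term.realize_le]
      intro x
      simpa [Fin.snoc] using Real.add_one_le_exp x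

/-- `OEF ⊆ Th(ℝ_exp)`. [folklore] -/
theorem OEF_subset_realExpTheory : Theory.OEF ⊆ realExpTheory := fun σ hσ =>
  Language.mem_completeTheory.2 (Real.model_OEF.realize_of_mem σ hσ)

/-! ### Models of `OEF` are ordered fields with an `IsOrderedExp` exponential -/

namespace OEFModel

variable (K : Language.Theory.ModelType.{0, 0, w} Theory.OEF)

/-- Axioms of `OEF` hold in its models. [folklore] -/
theorem realize_of_mem_algebraAxioms {σ : Language.orderedExpRing.Sentence}
    (h : σ ∈ OEF.algebraAxioms) : K ⊨ σ :=
  Language.Theory.realize_sentence_of_mem Theory.OEF (Set.mem_union_right _ h)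

variable {K}

/-- Addition of a model of `OEF`: the interpretation of `+`. [folklore] -/
instance : Add K := ⟨fun a b => funMap (L := Language.orderedExpRing) expRingFunc.add ![a, b]⟩
/-- Multiplication of a model of `OEF`: the interpretation of `*`. [folklore] -/
instance : Mul K := ⟨fun a b => funMap (L := Language.orderedExpRing) expRingFunc.mul ![a, b]⟩
/-- Negation of a model of `OEF`: the interpretation of `-`. [folklore] -/
instance : Neg K := ⟨fun a => funMap (L := Language.orderedExpRing) expRingFunc.neg ![a]⟩
/-- Zero of a model of `OEF`: the interpretation of `0`. [folklore] -/
instance : Zero K :=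
  ⟨funMap (L := Language.orderedExpRing) (expRingFunc.zero : Language.orderedExpRing.Functions 0)
    default⟩
/-- One of a model of `OEF`: the interpretation of `1`. [folklore] -/
instance : One K :=
  ⟨funMap (L := Language.orderedExpRing) (expRingFunc.one : Language.orderedExpRing.Functions 0)
    default⟩

/-- The exponential of a model of `OEF`: the interpretation of `exp`. [folklore] -/
def exp (a : K) : K := funMap (L := Language.orderedExpRing) expRingFunc.exp ![a]

/-- Interpretation of `+`. [folklore] -/
@[simp] theorem funMap_add (v : Fin 2 → K) :
    funMap (L := Language.orderedExpRing) expRingFunc.add v = v 0 + v 1 :=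
  congrArg _ (by ext i; fin_cases i <;> rfl)
/-- Interpretation of `*`. [folklore] -/
@[simp] theorem funMap_mul (v : Fin 2 → K) :
    funMap (L := Language.orderedExpRing) expRingFunc.mul v = v 0 * v 1 :=
  congrArg _ (by ext i; fin_cases i <;> rfl)
/-- Interpretation of `-`. [folklore] -/
@[simp] theorem funMap_neg (v : Fin 1 → K) :
    funMap (L := Language.orderedExpRing) expRingFunc.neg v = -v 0 :=
  congrArg _ (by ext i; fin_cases i; rfl)
/-- Interpretation of `0`. [folklore] -/
@[simp] theorem funMap_zero (v : Fin 0 → K) :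
    funMap (L := Language.orderedExpRing) expRingFunc.zero v = 0 :=
  congrArg _ (Subsingleton.elim _ _)
/-- Interpretation of `1`. [folklore] -/
@[simp] theorem funMap_one (v : Fin 0 → K) :
    funMap (L := Language.orderedExpRing) expRingFunc.one v = 1 :=
  congrArg _ (Subsingleton.elim _ _)
/-- Interpretation of `exp`. [folklore] -/
@[simp] theorem funMap_exp (v : Fin 1 → K) :
    funMap (L := Language.orderedExpRing) expRingFunc.exp v = exp (v 0) :=
  congrArg _ (by ext i; fin_cases i; rfl)
/-- The constant symbol `0` names `0`. [folklore] -/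
@[simp] theorem coe_zero : (constantMap (L := Language.orderedExpRing) expRingFunc.zero : K) = 0 := rfl
/-- The constant symbol `1` names `1`. [folklore] -/
@[simp] theorem coe_one : (constantMap (L := Language.orderedExpRing) expRingFunc.one : K) = 1 := rfl

section Terms
variable {α : Type*} (v : α → K)
/-- Realization of the term `0`. [folklore] -/
@[simp] theorem realize_zero : (0 : Language.orderedExpRing.Term α).realize v = 0 := by
  show (Constants.term _).realize v = 0
  rw [Term.realize_constants]; rfl
/-- Realization of the term `1`. [folklore] -/
@[simp] theorem realize_one : (1 : Language.orderedExpRing.Term α).realize v = 1 := by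
  show (Constants.term _).realize v = 1
  rw [Term.realize_constants]; rfl
/-- Realization of `t₁ + t₂`. [folklore] -/
@[simp] theorem realize_add (t₁ t₂ : Language.orderedExpRing.Term α) :
    (t₁ + t₂).realize v = t₁.realize v + t₂.realize v := by
  show (Functions.apply₂ _ t₁ t₂).realize v = _
  rw [Term.realize_functions_apply₂, funMap_add]; rfl
/-- Realization of `t₁ * t₂`. [folklore] -/
@[simp] theorem realize_mul (t₁ t₂ : Language.orderedExpRing.Term α) :
    (t₁ * t₂).realize v = t₁.realize v * t₂.realize v := by
  show (Functions.apply₂ _ t₁ t₂).realize v = _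
  rw [Term.realize_functions_apply₂, funMap_mul]; rfl
/-- Realization of `-t`. [folklore] -/
@[simp] theorem realize_neg (t : Language.orderedExpRing.Term α) :
    (-t).realize v = -t.realize v := by
  show (Functions.apply₁ _ t).realize v = _
  rw [Term.realize_functions_apply₁, funMap_neg]; rfl
/-- Realization of `exp t`. [folklore] -/
@[simp] theorem realize_termExp (t : Language.orderedExpRing.Term α) :
    (Language.orderedExpRing.termExp t).realize v = exp (t.realize v) := by
  show (Functions.apply₁ _ t).realize v = _
  rw [Term.realize_functions_apply₁, funMap_exp]; rfl
end Terms

/-! #### The order -/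

/-- A model of `OEF` is linearly ordered by the interpretation of `≤`. [folklore] -/
instance : LinearOrder K :=
  letI : DecidableRel fun a b : K =>
      RelMap (Language.leSymb : Language.orderedExpRing.Relations 2) ![a, b] :=
    Classical.decRel _
  haveI : K ⊨ Language.orderedExpRing.linearOrderTheory :=
    Language.Theory.Model.mono K.is_model Set.subset_union_left
  Language.orderedExpRing.linearOrderOfModels K

/-- `a ≤ b` is the interpretation of `≤` (by definition). [folklore] -/
theorem le_iff (a b : K) :
    a ≤ b ↔ RelMap (Language.leSymb : Language.orderedExpRing.Relations 2) ![a, b] := Iff.rfl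

/-- A model of `OEF` is an ordered structure in Mathlib's sense. [folklore] -/
instance : Language.orderedExpRing.OrderedStructure K where
  relMap_leSymb x := by
    have hx : ![x 0, x 1] = x := by ext i; fin_cases i <;> rfl
    rw [le_iff, hx]

/-- Interpretation of `≤`. [folklore] -/
@[simp] theorem relMap_le (v : Fin 2 → K) :
    RelMap (L := Language.orderedExpRing) Language.orderRel.le v ↔ v 0 ≤ v 1 :=
  Language.relMap_leSymb v

/-! #### The field structure -/

/-- An axiom of `OEF` in its models (auxiliary; use the `Field`/`IsStrictOrderedRing` instances). [folklore] -/
private theorem add_assoc' (a b c : K) : a + b + c = a + (b + c) := by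
  have h := realize_of_mem_algebraAxioms K (σ := OEF.addAssoc) (by simp [OEF.algebraAxioms])
  simp [OEF.addAssoc, Sentence.Realize, Formula.Realize, Fin.snoc] at h
  exact h a b c

/-- An axiom of `OEF` in its models (auxiliary; use the `Field`/`IsStrictOrderedRing` instances). [folklore] -/
private theorem zero_add' (a : K) : 0 + a = a := by
  have h := realize_of_mem_algebraAxioms K (σ := OEF.zeroAdd) (by simp [OEF.algebraAxioms])
  simp [OEF.zeroAdd, Sentence.Realize, Formula.Realize, Fin.snoc] at h
  exact h a

/-- An axiom of `OEF` in its models (auxiliary; use the `Field`/`IsStrictOrderedRing` instances). [folklore] -/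
private theorem neg_add_cancel' (a : K) : -a + a = 0 := by
  have h := realize_of_mem_algebraAxioms K (σ := OEF.negAddCancel) (by simp [OEF.algebraAxioms])
  simp [OEF.negAddCancel, Sentence.Realize, Formula.Realize, Fin.snoc] at h
  exact h a

/-- An axiom of `OEF` in its models (auxiliary; use the `Field`/`IsStrictOrderedRing` instances). [folklore] -/
private theorem mul_assoc' (a b c : K) : a * b * c = a * (b * c) := by
  have h := realize_of_mem_algebraAxioms K (σ := OEF.mulAssoc) (by simp [OEF.algebraAxioms])
  simp [OEF.mulAssoc, Sentence.Realize, Formula.Realize, Fin.snoc] at h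
  exact h a b c

/-- An axiom of `OEF` in its models (auxiliary; use the `Field`/`IsStrictOrderedRing` instances). [folklore] -/
private theorem mul_comm' (a b : K) : a * b = b * a := by
  have h := realize_of_mem_algebraAxioms K (σ := OEF.mulComm) (by simp [OEF.algebraAxioms])
  simp [OEF.mulComm, Sentence.Realize, Formula.Realize, Fin.snoc] at h
  exact h a b

/-- An axiom of `OEF` in its models (auxiliary; use the `Field`/`IsStrictOrderedRing` instances). [folklore] -/
private theorem one_mul' (a : K) : 1 * a = a := by
  have h := realize_of_mem_algebraAxioms K (σ := OEF.oneMul) (by simp [OEF.algebraAxioms])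
  simp [OEF.oneMul, Sentence.Realize, Formula.Realize, Fin.snoc] at h
  exact h a

/-- An axiom of `OEF` in its models (auxiliary; use the `Field`/`IsStrictOrderedRing` instances). [folklore] -/
private theorem exists_inv' (a : K) (ha : a ≠ 0) : ∃ b : K, a * b = 1 := by
  have h := realize_of_mem_algebraAxioms K (σ := OEF.existsInv) (by simp [OEF.algebraAxioms])
  simp [OEF.existsInv, Sentence.Realize, Formula.Realize, Fin.snoc] at h
  exact h a ha

/-- An axiom of `OEF` in its models (auxiliary; use the `Field`/`IsStrictOrderedRing` instances). [folklore] -/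
private theorem left_distrib' (a b c : K) : a * (b + c) = a * b + a * c := by
  have h := realize_of_mem_algebraAxioms K (σ := OEF.leftDistrib) (by simp [OEF.algebraAxioms])
  simp [OEF.leftDistrib, Sentence.Realize, Formula.Realize, Fin.snoc] at h
  exact h a b c

/-- An axiom of `OEF` in its models (auxiliary; use the `Field`/`IsStrictOrderedRing` instances). [folklore] -/
private theorem zero_ne_one' : (0 : K) ≠ 1 := by
  have h := realize_of_mem_algebraAxioms K (σ := OEF.zeroNeOne) (by simp [OEF.algebraAxioms])
  simpa [OEF.zeroNeOne, Sentence.Realize, Formula.Realize] using h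

/-- A model of `OEF` is a field (`Field.ofMinimalAxioms` on the axioms of `OEF`). [folklore] -/
instance : Field K :=
  letI : Inv K := ⟨fun a => if ha : a = 0 then 0 else Classical.choose (exists_inv' a ha)⟩
  Field.ofMinimalAxioms K add_assoc' zero_add' neg_add_cancel' mul_assoc' mul_comm' one_mul'
    (fun a ha => show a * (dite _ _ _) = 1 by
      rw [dif_neg ha]; exact Classical.choose_spec (exists_inv' a ha))
    (dif_pos rfl) left_distrib' ⟨0, 1, zero_ne_one'⟩

/-- An axiom of `OEF` in its models (auxiliary; use the `Field`/`IsStrictOrderedRing` instances). [folklore] -/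
private theorem add_le_add_left' (a b : K) (hab : a ≤ b) (c : K) : a + c ≤ b + c := by
  have h := realize_of_mem_algebraAxioms K (σ := OEF.addLeAdd) (by simp [OEF.algebraAxioms])
  simp only [OEF.addLeAdd, Sentence.Realize, Formula.Realize, BoundedFormula.realize_all,
    BoundedFormula.realize_imp, Term.realize_le] at h
  simpa [Fin.snoc] using h a b c (by simpa [Fin.snoc] using hab)

/-- An axiom of `OEF` in its models (auxiliary; use the `Field`/`IsStrictOrderedRing` instances). [folklore] -/
private theorem zero_le_one' : (0 : K) ≤ 1 := by
  have h := realize_of_mem_algebraAxioms K (σ := OEF.zeroLeOne) (by simp [OEF.algebraAxioms])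
  simpa [OEF.zeroLeOne, Sentence.Realize, Formula.Realize] using h

/-- An axiom of `OEF` in its models (auxiliary; use the `Field`/`IsStrictOrderedRing` instances). [folklore] -/
private theorem mul_pos' (a b : K) (ha : 0 < a) (hb : 0 < b) : 0 < a * b := by
  have h := realize_of_mem_algebraAxioms K (σ := OEF.mulPos) (by simp [OEF.algebraAxioms])
  simp only [OEF.mulPos, Sentence.Realize, Formula.Realize, BoundedFormula.realize_all,
    BoundedFormula.realize_imp, Term.realize_lt] at h
  simpa [Fin.snoc] using h a b (by simpa [Fin.snoc] using ha) (by simpa [Fin.snoc] using hb)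

/-- Addition in a model of `OEF` is monotone. [folklore] -/
instance : IsOrderedAddMonoid K where
  add_le_add_left a b hab c := add_le_add_left' a b hab c

/-- A model of `OEF` is a (strictly) ordered field. [folklore] -/
instance : IsStrictOrderedRing K :=
  haveI : ZeroLEOneClass K := ⟨zero_le_one'⟩
  IsStrictOrderedRing.of_mul_pos mul_pos'

/-- A model of `OEF` is a lawful structure (`RealExpTransfer.lean`): its symbols `+, *, -, 0, 1, ≤`
are interpreted by the field operations and the order. [folklore] -/
instance : RealExpModel.LawfulStructure K where
  funMap_add := funMap_add
  funMap_mul := funMap_mul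
  funMap_neg := funMap_neg
  funMap_zero := funMap_zero
  funMap_one := funMap_one
  relMap_le := relMap_le

/-- In a model of `OEF` every non-negative element is a square. [folklore] -/
theorem exists_mul_self_eq {a : K} (ha : 0 ≤ a) : ∃ b : K, b * b = a := by
  have h := realize_of_mem_algebraAxioms K (σ := OEF.squares) (by simp [OEF.algebraAxioms])
  simp only [OEF.squares, Sentence.Realize, Formula.Realize, BoundedFormula.realize_all,
    BoundedFormula.realize_imp, Term.realize_le, BoundedFormula.realize_ex,
    BoundedFormula.realize_bdEqual] at h
  obtain ⟨b, hb⟩ := h a (by simpa [Fin.snoc] using ha)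
  exact ⟨b, by simpa [Fin.snoc] using hb⟩

/-- In a model of `OEF`, `a ≤ b` iff `b - a` is a square. [folklore] -/
theorem le_iff_exists_mul_self (a b : K) : a ≤ b ↔ ∃ c : K, b - a = c * c := by
  constructor
  · intro h
    obtain ⟨c, hc⟩ := exists_mul_self_eq (sub_nonneg.2 h)
    exact ⟨c, hc.symm⟩
  · rintro ⟨c, hc⟩
    exact sub_nonneg.1 (hc ▸ mul_self_nonneg c)

/-- In a model of `OEF`, `a < b` iff `(b - a) c² = 1` for some `c`. [folklore] -/
theorem lt_iff_exists_mul_self (a b : K) : a < b ↔ ∃ c : K, (b - a) * (c * c) = 1 := by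
  constructor
  · intro h
    have hba : 0 < b - a := sub_pos.2 h
    obtain ⟨c, hc⟩ := exists_mul_self_eq (inv_nonneg.2 hba.le)
    exact ⟨c, by rw [hc, mul_inv_cancel₀ hba.ne']⟩
  · rintro ⟨c, hc⟩
    have h1 : 0 < (b - a) * (c * c) := by rw [hc]; exact one_pos
    rcases pos_and_pos_or_neg_and_neg_of_mul_pos h1 with ⟨h2, -⟩ | ⟨-, h2⟩
    · exact sub_pos.1 h2
    · exact absurd h2 (not_lt.2 (mul_self_nonneg c))

/-- In a model of `OEF`, `a ≠ b` iff `(a - b) c = 1` for some `c`. [folklore] -/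
theorem ne_iff_exists_mul_eq_one (a b : K) : a ≠ b ↔ ∃ c : K, (a - b) * c = 1 :=
  ⟨fun h => ⟨(a - b)⁻¹, mul_inv_cancel₀ (sub_ne_zero.2 h)⟩,
    fun ⟨c, hc⟩ h => by simp [h] at hc⟩

/-! #### The exponential -/

/-- `exp (a + b) = exp a * exp b` in every model of `OEF`. [folklore] -/
theorem exp_add (a b : K) : exp (a + b) = exp a * exp b := by
  have h := realize_of_mem_algebraAxioms K (σ := OEF.expAdd) (by simp [OEF.algebraAxioms])
  simp [OEF.expAdd, Sentence.Realize, Formula.Realize, Fin.snoc] at h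
  exact h a b

/-- `a + 1 ≤ exp a` in every model of `OEF`. [folklore] -/
theorem add_one_le_exp (a : K) : a + 1 ≤ exp a := by
  have h := realize_of_mem_algebraAxioms K (σ := OEF.addOneLeExp) (by simp [OEF.algebraAxioms])
  simp only [OEF.addOneLeExp, Sentence.Realize, Formula.Realize, BoundedFormula.realize_all,
    Term.realize_le] at h
  simpa [Fin.snoc] using h a

/-- The exponential of a model of `OEF` is an ordered exponential in the weak sense of
`ClosedTermTransfer.lean`. [folklore] -/
theorem isOrderedExp_exp : IsOrderedExp (exp : K → K) := ⟨exp_add, add_one_le_exp⟩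

/-- `0 < exp a` in every model of `OEF` (from `IsOrderedExp`). [folklore] -/
theorem exp_pos (a : K) : 0 < exp a := isOrderedExp_exp.pos a

/-- `exp 0 = 1` in every model of `OEF` (from `IsOrderedExp`). [folklore] -/
@[simp] theorem exp_zero : exp (0 : K) = 1 := isOrderedExp_exp.map_zero

/-- `exp` is strictly monotone in every model of `OEF` (from `IsOrderedExp`). [folklore] -/
theorem exp_lt_exp {a b : K} (hab : a < b) : exp a < exp b := isOrderedExp_exp.strictMono hab

/-! #### The ordered-ring reduct -/

/-- The `Language.orderedRing`-structure of a model of `OEF` given by its operations and order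
(`Language.orderedRing.instStructure`) is the reduct of its `Language.orderedExpRing`-structure
along `orderedRingHomOrderedExpRing`. [folklore] -/
instance : orderedRingHomOrderedExpRing.IsExpansionOn K where
  map_onFunction f v := by
    cases f
    · exact funMap_add v
    · exact funMap_mul v
    · exact funMap_neg v
    · exact funMap_zero v
    · exact funMap_one v
  map_onRelation r v := by cases r; exact propext (relMap_le v)

/-- Realization of a transported `Language.orderedRing`-term is its realization in the reduct. [folklore] -/
@[simp] theorem realize_onTerm {α : Type*} (p : Language.orderedRing.Term α) (v : α → K) :
    (orderedRingHomOrderedExpRing.onTerm p).realize v = p.realize v :=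
  Language.LHom.realize_onTerm _ p v

end OEFModel

/-! ### Models of theories proving `OEF` -/

/-- A theory `T` *proves `OEF`* if every axiom of `OEF` is a (semantic) consequence of `T`.
This — rather than the set inclusion `Theory.OEF ⊆ T` of these particular fifteen sentences — is
the hypothesis under which the results below are stated, so that they apply to any theory
containing, e.g., a transport of the tree's `Theory.RCF` (`RealClosedFieldTheory.lean`) along
`orderedRingHomOrderedExpRing` together with `OEF.expAdd`, `OEF.addOneLeExp`, once the
(elementary) entailments are checked; `modelsOEF_of_subset` is the trivial case `OEF ⊆ T`, which
covers the theories `OEF ∪ S` (`S` a scheme of further true sentences) used in this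
decomposition of Macintyre–Wilkie's theorem. [folklore] -/
def Theory.ModelsOEF (T : Language.orderedExpRing.Theory) : Prop :=
  ∀ σ ∈ Theory.OEF, T ⊨ᵇ σ

/-- `T ⊇ OEF` proves `OEF`. [folklore] -/
theorem modelsOEF_of_subset {T : Language.orderedExpRing.Theory} (hT : Theory.OEF ⊆ T) :
    Theory.ModelsOEF T :=
  fun _ hσ => Language.Theory.models_sentence_of_mem (hT hσ)

/-- `OEF` proves `OEF`. [folklore] -/
theorem modelsOEF_OEF : Theory.ModelsOEF Theory.OEF :=
  modelsOEF_of_subset subset_rfl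

/-- `Th(ℝ_exp)` proves `OEF`. [folklore] -/
theorem modelsOEF_realExpTheory : Theory.ModelsOEF realExpTheory :=
  modelsOEF_of_subset OEF_subset_realExpTheory

/-- Proving `OEF` is monotone in the theory. [folklore] -/
theorem Theory.ModelsOEF.mono {T T' : Language.orderedExpRing.Theory} (h : Theory.ModelsOEF T)
    (hTT' : T ⊆ T') : Theory.ModelsOEF T' :=
  fun σ hσ => Language.Theory.models_sentence_mono hTT' (h σ hσ)

/-- A model of a theory proving `OEF` is a model of `OEF` **with the same carrier and the same
structure**, so that the instances and lemmas of `OEFModel` apply to it. [folklore] -/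
def Theory.ModelType.toOEFModel {T : Language.orderedExpRing.Theory} (hT : Theory.ModelsOEF T)
    (M : Language.Theory.ModelType.{0, 0, w} T) : Language.Theory.ModelType.{0, 0, w} Theory.OEF where
  Carrier := M
  struc := M.struc
  is_model := ⟨fun σ hσ => (hT σ hσ).realize_sentence M⟩
  nonempty' := M.nonempty'

/-- The carrier of `toOEFModel hT M` is the carrier of `M` (by `rfl`). [folklore] -/
theorem Theory.ModelType.coe_toOEFModel {T : Language.orderedExpRing.Theory} (hT : Theory.ModelsOEF T)
    (M : Language.Theory.ModelType.{0, 0, w} T) : (Theory.ModelType.toOEFModel hT M : Type w) = M :=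
  rfl

/-! ### `OEF ⊨ s < t` for true closed strict inequalities -/

/-- **`OEF` proves every true strict inequality between closed terms**: if `s, t` are closed
terms of `Language.orderedExpRing` (no variables) with `ℝ ⊨ s < t`, then `OEF ⊨ s < t` — every
model of `OEF` is an ordered field with a lawful structure and an `IsOrderedExp` exponential,
to which `realize_expFormulaLt_of_real` (`ClosedTermTransfer.lean`) applies.  This is the
theory-level form of Jones–Servi 2011, Lemma 3.6 ("`ℝ^α ⊨ h(q̄) < 0` ⇒ `T ⊢ h(q̄) < 0`") for the
exponential and the finite theory `OEF`. [cite: JonesServi2011, Lemma 3.6] -/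
theorem OEF_models_expFormulaLt_of_real {s t : Language.orderedExpRing.Term Empty}
    (h : (ExpFormula.lt s t).Realize (default : Empty → ℝ)) :
    Theory.OEF ⊨ᵇ ExpFormula.lt s t := by
  refine Language.Theory.models_sentence_iff.2 fun K => ?_
  exact realize_expFormulaLt_of_real default h K OEFModel.exp OEFModel.isOrderedExp_exp
    OEFModel.funMap_exp default

/-- The same for every theory `T` proving `OEF` (in particular for the theories `OEF ∪ S` of this
decomposition, for any `T ⊇ OEF`, and for `Th(ℝ_exp)` itself): every model of `T` is a model of
`OEF` with the same structure. [cite: JonesServi2011, Lemma 3.6] -/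
theorem models_expFormulaLt_of_real {T : Language.orderedExpRing.Theory} (hT : Theory.ModelsOEF T)
    {s t : Language.orderedExpRing.Term Empty}
    (h : (ExpFormula.lt s t).Realize (default : Empty → ℝ)) : T ⊨ᵇ ExpFormula.lt s t := by
  refine Language.Theory.models_sentence_iff.2 fun K => ?_
  exact realize_expFormulaLt_of_real default h (Theory.ModelType.toOEFModel hT K) OEFModel.exp
    OEFModel.isOrderedExp_exp OEFModel.funMap_exp default

/-- In every model `K` of a theory proving `OEF`, viewed through `toOEFModel`: true closed strict
inequalities of `ℝ_exp` hold (pointwise form, for use inside arguments about a fixed model). [cite: JonesServi2011, Lemma 3.6] -/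
theorem realize_lt_of_real_of_modelsOEF {T : Language.orderedExpRing.Theory}
    (hT : Theory.ModelsOEF T) (K : Language.Theory.ModelType.{0, 0, 0} T) {α : Type} [IsEmpty α]
    {s t : Language.orderedExpRing.Term α} (v₀ : α → ℝ) (h : s.realize v₀ < t.realize v₀)
    (v : α → Theory.ModelType.toOEFModel hT K) : s.realize v < t.realize v :=
  realize_lt_realize_of_real v₀ h (Theory.ModelType.toOEFModel hT K) OEFModel.exp
    OEFModel.isOrderedExp_exp OEFModel.funMap_exp v

end Literature.ModelTheory.ExponentialFields

end
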